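import Mathlib
import Summits.NavierStokesRegularity.NavierStokesRegularity.Theorems.FilamentSkeletonRssKelvinGateSharpGateSpec
import Summits.NavierStokesRegularity.NavierStokesRegularity.Theorems.FilamentSkeletonRssKelvinGateClosingStatic
import Summits.NavierStokesRegularity.NavierStokesRegularity.Theorems.FilamentSkeletonRssKelvinGateSmoothing
import Summits.NavierStokesRegularity.NavierStokesRegularity.Theorems.FilamentSkeletonRssKelvinGateFreeBaseProfiles

/-!
# Route `FilamentSkeletonRss` · crux `TransverseReduction1A` (stmt-27414; successor of the aside `TransverseReductionRJ`,
# stmt-21221) — line `kelvin_gate`: the sharp closing delivers SMOOTH, DIVERGENCE-FREE, DECAYING exact profiles (S3′ + S4′)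

Helper file (theorems only, `--as helper`).  HONEST FRAMING: analysis bookkeeping for a HYPOTHETICAL filament-type rotating
self-similar blow-up route; nothing here bears on Navier–Stokes regularity; no stub is proved here; `TransverseReduction1A` is
neither proved nor refuted.

`SharpGateSpec.closing` (S2′ ⇒ S3′) produces `W ∈ X♯_a`, `Q ∈ C¹` with `E_α(U⁰ + W) + ∇(P⁰ + Q) = 0`.  Here the output is dressed
to the shape of the crux's conclusion block:

* `SharpGateSpec.closing_smooth` — if moreover `U⁰ ∈ C²` is divergence free and `P⁰ ∈ C¹`, then `U := U⁰ + W`, `P := P⁰ + Q` are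
  `C^∞` (the line's S4 ladder `…KelvinGateSmoothing.Smoothing.contDiff_velocity_infty / contDiff_pressure_infty` with zero
  forcing), `U` is divergence free, solves the rotating Leray profile equation VERBATIM in the crux's pointwise vocabulary
  `α(e₃ × U − DU[e₃ × y]) + ½U + ½DU[y] − ΔU + DU[U] + ∇P = 0`, and inherits the decay `‖W‖ ≤ 2Aε/(1+|y|)`, `|Q| ≤ 2Aε`;
* `small_free_profiles_smooth` — the free-base instance: small forced profiles (`small_free_profiles`) are `C^∞` when the forcing is.
What remains between this and `TransverseReduction1A`'s conclusion: the base's own decay/bounds (`|U⁰| ≤ C/(1+|y|)`, `|P⁰| ≤ M`),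
`U ≠ 0`, and the waist-ball closeness to `u_X` — all properties of the DRESSED BASE (S1′), plus the gate S2′ itself.
-/

set_option linter.dupNamespace false

noncomputable section

namespace Summit.NavierStokesRegularity.NavierStokesRegularity.Theorems.KelvinGate

open Set Function Filter MeasureTheory
open Literature.Analysis.FluidPDE
open scoped InnerProductSpace Laplacian ContDiff Topology BigOperators

/-- **S3′ + S4′ from a sharp gate.**  See the module docstring. -/
theorem SharpGateSpec.closing_smooth {a A α ε : ℝ} {U0 : EuclideanSpace ℝ (Fin 3) → EuclideanSpace ℝ (Fin 3)}
    {K : (EuclideanSpace ℝ (Fin 3) → EuclideanSpace ℝ (Fin 3)) → EuclideanSpace ℝ (Fin 3) → EuclideanSpace ℝ (Fin 3)}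
    {𝒬 : (EuclideanSpace ℝ (Fin 3) → EuclideanSpace ℝ (Fin 3)) → EuclideanSpace ℝ (Fin 3) → ℝ}
    (hg : SharpGateSpec a A α U0 K 𝒬) (ha1 : 1 ≤ a) (hU0 : ContDiff ℝ 2 U0) (hU0div : VectorCalculus.IsDivFree U0)
    {P0 : EuclideanSpace ℝ (Fin 3) → ℝ} (hP0 : ContDiff ℝ 1 P0)
    {r : EuclideanSpace ℝ (Fin 3) → EuclideanSpace ℝ (Fin 3)} (hres : ∀ y, lerayOp α U0 y + gradient P0 y = r y)
    (hr : YSharp a r ε) (hA : 16 * A ^ 2 * ε ≤ 1) :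
    ∃ (W : EuclideanSpace ℝ (Fin 3) → EuclideanSpace ℝ (Fin 3)) (Q : EuclideanSpace ℝ (Fin 3) → ℝ),
      XSharp a W (2 * A * ε) ∧ (∀ y, |Q y| ≤ 2 * A * ε) ∧ (∀ y, ‖W y‖ ≤ 2 * A * ε / (1 + ‖y‖)) ∧
      ContDiff ℝ (⊤ : ℕ∞) (fun z => U0 z + W z) ∧ ContDiff ℝ (⊤ : ℕ∞) (fun z => P0 z + Q z) ∧
      VectorCalculus.IsDivFree (fun z => U0 z + W z) ∧
      ∀ y, α • (cross (EuclideanSpace.single 2 1) ((fun z => U0 z + W z) y) -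
          fderiv ℝ (fun z => U0 z + W z) y (cross (EuclideanSpace.single 2 1) y)) + (1/2:ℝ) • (fun z => U0 z + W z) y +
          (1/2:ℝ) • fderiv ℝ (fun z => U0 z + W z) y y - (Laplacian.laplacian (fun z => U0 z + W z)) y +
          fderiv ℝ (fun z => U0 z + W z) y ((fun z => U0 z + W z) y) + gradient (fun z => P0 z + Q z) y = 0 := by
  obtain ⟨W, Q, hX, hdiv, hQ1, hQb, heq⟩ := hg.closing ha1 hU0 hP0.differentiable_one hres hr hA
  have hW2 : ContDiff ℝ 2 W := hX.1
  have hU2 : ContDiff ℝ 2 (fun z => U0 z + W z) := hU0.add hW2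
  have hP1 : ContDiff ℝ 1 (fun z => P0 z + Q z) := hP0.add hQ1
  have hUdiv : VectorCalculus.IsDivFree (fun z => U0 z + W z) :=
    isDivFree_add hU0div hdiv (hU0.differentiable (by norm_num)) (hW2.differentiable (by norm_num))
  have heq' : ∀ y, α • (cross (EuclideanSpace.single 2 1) ((fun z => U0 z + W z) y) -
      fderiv ℝ (fun z => U0 z + W z) y (cross (EuclideanSpace.single 2 1) y)) + (1/2:ℝ) • (fun z => U0 z + W z) y +
      (1/2:ℝ) • fderiv ℝ (fun z => U0 z + W z) y y - (Laplacian.laplacian (fun z => U0 z + W z)) y +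
      fderiv ℝ (fun z => U0 z + W z) y ((fun z => U0 z + W z) y) + gradient (fun z => P0 z + Q z) y =
      (fun _ : EuclideanSpace ℝ (Fin 3) => (0 : EuclideanSpace ℝ (Fin 3))) y := fun y => heq y
  have hF : ContDiff ℝ ∞ (fun _ : EuclideanSpace ℝ (Fin 3) => (0 : EuclideanSpace ℝ (Fin 3))) := contDiff_const
  have hUs := Smoothing.contDiff_velocity_infty hU2 hUdiv hP1 hF heq'
  have hPs := Smoothing.contDiff_pressure_infty hU2 hUdiv hP1 hF heq'
  refine ⟨W, Q, hX, hQb, fun y => ?_, hUs, hPs, hUdiv, heq⟩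
  rw [le_div_iff₀ (by positivity), mul_comm]
  exact (hX.2 y).1

/-- **Small forced free profiles are smooth when the forcing is.**  In `small_free_profiles` (trivial base, every rate `α`):
if `g ∈ C^∞` then the profile `W` and the pressure `Q` are `C^∞`. -/
theorem small_free_profiles_smooth {a : ℝ} (ha1 : 1 < a) (ha2 : a < 2) :
    ∃ C ε₀ : ℝ, 0 ≤ C ∧ 0 < ε₀ ∧ ∀ (α : ℝ) (g : EuclideanSpace ℝ (Fin 3) → EuclideanSpace ℝ (Fin 3)) (ε : ℝ),
      YSharp a g ε → ε ≤ ε₀ → ContDiff ℝ ∞ g →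
      ∃ (W : EuclideanSpace ℝ (Fin 3) → EuclideanSpace ℝ (Fin 3)) (Q : EuclideanSpace ℝ (Fin 3) → ℝ),
        XSharp a W (C * ε) ∧ VectorCalculus.IsDivFree W ∧ (∀ y, |Q y| ≤ C * ε) ∧
        ContDiff ℝ (⊤ : ℕ∞) W ∧ ContDiff ℝ (⊤ : ℕ∞) Q ∧ ∀ y, lerayOp α W y + gradient Q y = g y := by
  obtain ⟨C, ε₀, hC0, hε₀, h⟩ := small_free_profiles ha1 ha2
  refine ⟨C, ε₀, hC0, hε₀, fun α g ε hg hε hgs => ?_⟩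
  obtain ⟨W, Q, hX, hQ1, hdiv, hQb, heq⟩ := h α g ε hg hε
  have heq' : ∀ y, α • (cross (EuclideanSpace.single 2 1) (W y) - fderiv ℝ W y (cross (EuclideanSpace.single 2 1) y)) +
      (1/2:ℝ) • W y + (1/2:ℝ) • fderiv ℝ W y y - (Laplacian.laplacian W) y + fderiv ℝ W y (W y) + gradient Q y = g y :=
    fun y => heq y
  exact ⟨W, Q, hX, hdiv, hQb, Smoothing.contDiff_velocity_infty hX.1 hdiv hQ1 hgs heq',
    Smoothing.contDiff_pressure_infty hX.1 hdiv hQ1 hgs heq', heq⟩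

end Summit.NavierStokesRegularity.NavierStokesRegularity.Theorems.KelvinGate

end
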